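import Summits.AtomisticToContinuum.BoseEinsteinCondensation.Theses.BECNoCheapMomentum

/-!
# AtomisticToContinuum / BoseEinsteinCondensation — route `BECNoCheapMomentum`, assembly

Settles the assembly item `stmt-AtomisticToContinuum-11848` of route
`route-AtomisticToContinuum-BECNoCheapMomentum`: the implication
`SectorGapFloor → HardCoreMomentBound → BoundaryTransferWeak → ZeroMomentumGround →
MomentBoundCondensation → FreeGasCondensation → BoseEinsteinCondensation`.

The hypotheses of `Assembly` are, verbatim and in the same order, those of the route's deciding
theorem `closes`; the composition is spelled out again here for the record. Fix a repulsive
finite-range `v`; `BoundaryTransferWeak` reduces ground-state (Dirichlet) BEC for `v` at all small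
densities to the periodic-BEC body for `v`, which is obtained by trichotomy on `∫⁻ x, v ‖x‖`:
`= 0` — `FreeGasCondensation`; `= ⊤` — `HardCoreMomentBound` fed with `SectorGapFloor`;
otherwise — `MomentBoundCondensation` fed with `ZeroMomentumGround` and `SectorGapFloor`.
Pure logic; no analytic content lives here.
-/

namespace Summit.AtomisticToContinuum.BoseEinsteinCondensation.Theorems

/-- Settles `stmt-AtomisticToContinuum-11848` (exact signature): the assembly of route
`BECNoCheapMomentum`, i.e. its six items imply the sub-problem statement
`BoseEinsteinCondensation`. Proof: for each admissible `v`, `BoundaryTransferWeak` applied to the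
periodic-BEC body produced by `FreeGasCondensation` (`∫v = 0`), `HardCoreMomentBound ∘
SectorGapFloor` (`∫v = ⊤`) or `MomentBoundCondensation` with `ZeroMomentumGround` and
`SectorGapFloor` (`0 < ∫v < ⊤`). [folklore] -/
theorem becNoCheapMomentum_assembly_proof :
    Summit.AtomisticToContinuum.BoseEinsteinCondensation.Theses.BECNoCheapMomentum.Assembly := by
  unfold Theses.BECNoCheapMomentum.Assembly
  intro h1 h2 h3 h4 h5 h6 v hv
  refine h3 v hv ?_
  by_cases h0 : (∫⁻ x : EuclideanSpace ℝ (Fin 3), v ‖x‖) = 0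
  · exact h6 v hv h0
  · by_cases htop : (∫⁻ x : EuclideanSpace ℝ (Fin 3), v ‖x‖) = ⊤
    · exact h2 v hv htop (h1 v hv h0)
    · exact h5 v hv htop h0 (h4 v hv htop) (h1 v hv h0)

end Summit.AtomisticToContinuum.BoseEinsteinCondensation.Theorems
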